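import Literature.Claims.NS.Magsanop2026
import Literature.Analysis.FluidPDE.ClassicalNSFiniteEnergyEquality
import HarnessLib

/-!
# NS-claims map, C145 (Magsanop 2026): the energy law `∫₀ᵀ ‖∇u‖²_{L²} dt ≤ E(0)/ν` is TRUE along the
# typed class (salvage, kernel)

Claim C145 of cell `ns-claims` (D-0090): Marvin Magsanop, *Global Regularity for the 3D
Navier-Stokes Equations via Energy Decay, BKM Criterion, and 4D Viscous Extension*, Zenodo record
20719707 «Version 4.0» (bib `Magsanop2026`), skeleton `Literature.Claims.NS.Magsanop2026` (typist
ns-claims-typist-9 g5).  The printed sentence p.3 l.17–20 «Since ∫₀^∞‖∇u‖²_{L²} dt = E(0)/ν < ∞» is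
typed as `Step_energyId`: along every solution of the class `IsSol ν T u₀ u p` (a classical solution
of the unforced system on `ℝ³ × [0, T)` from the datum, with finite energy on `[0, T)`), the slice
dissipation `t ↦ ‖∇u(t)‖²_{L²} = VectorCalculus.gradNormSq (u t)` is integrable on `[0, T)` with
`∫₀ᵀ ‖∇u‖²_{L²} ≤ E(0)/ν`, `E = ½∫|u|²` (an inequality — the identity holds with `E(0) − E(T)` —
which is all the sentence uses).  This is Leray's energy law (Leray 1934 §17 (3.4); for
finite-energy CLASSICAL solutions with no decay hypothesis on the datum: Tao 2013 Lemma 8.1), in the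
tree as `IsClassicalNSSolutionOn.energyEq_finiteEnergy` / `energyClass_of_finiteEnergy` on closed
slabs `[0, T″]`; here we exhaust `[0, T)` by closed slabs (monotone convergence of the lower
integrals, `setLIntegral_iUnion_of_directed`) and convert the lower-integral dissipation to the
printed Bochner form.  No datum decay is needed, so the smooth-`H¹` data of the typed class are
covered.

* `step_energyId_holds : Literature.Claims.NS.Magsanop2026.Step_energyId`.

Records-grade (the located step of row C145 is the refuter's; this discharges a TRUE step, D-0026).
Salvage seat ns-claims-salvage-p4 g4.  Axioms: `propext`, `Classical.choice`, `Quot.sound` only.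
WHAT THIS IS NOT: not a claim about NS regularity or blow-up; not a claim about any author beyond
the typed locator.
-/

noncomputable section

open MeasureTheory Set Filter Function
open scoped ENNReal NNReal Topology ContDiff

-- The summit's canonical theorem namespace repeats the summit name (single-conjunct summit).
set_option linter.dupNamespace false

namespace Summit.NavierStokesRegularity.NavierStokesRegularity.Theorems.Magsanop2026

open Literature.Analysis.FluidPDE Literature.Claims.NS.Magsanop2026

/-- For a classical solution on `[0, T)`, the slice dissipation `τ ↦ ∫⁻ |∇u(τ)|²_F` is a.e.
measurable on `[0, T)` (Tonelli, from the joint continuity of `∇u` on `[0, T) × ℝ³`). [folklore] -/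
theorem aemeasurable_sliceD {ν T : ℝ} {u : ℝ → E3 → E3} {p : ℝ → E3 → ℝ}
    (h : IsClassicalNSSolutionOn (Ico 0 T) ν 0 u p) :
    AEMeasurable (fun τ => ∫⁻ x, ENNReal.ofReal (frobeniusNormSq (fderiv ℝ (u τ) x)))
      ((volume : Measure ℝ).restrict (Ico 0 T)) := by
  have hcont : ContinuousOn (fun z : ℝ × E3 => fderiv ℝ (u z.1) z.2) (Ico 0 T ×ˢ univ) :=
    h.smooth_velocity.continuousOn_fderiv_slice (uniqueDiffOn_Ico 0 T)
  have hF : ContinuousOn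
      (fun z : ℝ × E3 => ENNReal.ofReal (frobeniusNormSq (fderiv ℝ (u z.1) z.2)))
      (Ico 0 T ×ˢ univ) :=
    (ENNReal.continuous_ofReal.comp LerayHopfProofs.continuous_frobeniusNormSq).comp_continuousOn
      hcont
  have hFm : AEMeasurable
      (fun z : ℝ × E3 => ENNReal.ofReal (frobeniusNormSq (fderiv ℝ (u z.1) z.2)))
      (((volume : Measure ℝ).restrict (Ico 0 T)).prod (volume : Measure E3)) := by
    rw [Measure.restrict_prod_eq_prod_univ]
    exact hF.aemeasurable (measurableSet_Ico.prod MeasurableSet.univ)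
  exact hFm.lintegral_prod_right'

/-- For a smooth slice, the printed Bochner dissipation `∫ |∇u(τ)|²_F dx = gradNormSq (u τ)` is the
`toReal` of the lower integral (no integrability needed: both sides vanish/junk together). [folklore] -/
theorem gradNormSq_eq_toReal {v : E3 → E3} (hv : ContDiff ℝ ∞ v) :
    VectorCalculus.gradNormSq v =
      (∫⁻ x, ENNReal.ofReal (frobeniusNormSq (fderiv ℝ v x))).toReal := by
  unfold VectorCalculus.gradNormSq
  refine integral_eq_lintegral_of_nonneg_ae (Eventually.of_forall fun x => frobeniusNormSq_nonneg _)
    ?_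
  exact (LerayHopfProofs.continuous_frobeniusNormSq.comp (hv.continuous_fderiv (by simp))).aestronglyMeasurable

/-- On a closed sub-slab `[0, T″] ⊂ [0, T)` the lower-integral dissipation is bounded by `E(0)/ν`
(Leray's energy equality for finite-energy classical solutions, Tao 2013 Lemma 8.1, tree
`IsClassicalNSSolutionOn.energyEq_finiteEnergy`). [cite: Tao2011, Lemma 8.1] -/
theorem lintegral_sliceD_le_of_lt {ν T T'' : ℝ} {u₀ : E3 → E3} {u : ℝ → E3 → E3} {p : ℝ → E3 → ℝ}
    (hν : 0 < ν) (h : IsSol ν T u₀ u p) (hT'' : 0 < T'') (hT''T : T'' < T) :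
    ∫⁻ τ in Ioo 0 T'', ∫⁻ x, ENNReal.ofReal (frobeniusNormSq (fderiv ℝ (u τ) x)) ≤
      ENNReal.ofReal (energy u₀ / ν) := by
  have hcl : IsClassicalNSSolutionOn (Icc 0 T'') ν 0 u p :=
    h.classical.mono (Icc_subset_Ico_right hT''T) (uniqueDiffOn_Icc hT'')
  obtain ⟨A, hA, hAE⟩ := h.energy
  have hfe : ∃ A : ℝ≥0∞, A < ⊤ ∧ ∀ t ∈ Icc 0 T'', ∫⁻ x, ‖u t x‖ₑ ^ 2 ≤ A :=
    ⟨A, hA, fun t ht => hAE t ⟨ht.1, lt_of_le_of_lt ht.2 hT''T⟩⟩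
  obtain ⟨B, hBt, -, -, hfin⟩ := energyClass_of_finiteEnergy hcl hν hT'' hfe
  have hE := hcl.energyEq_finiteEnergy hν hT'' hfe le_rfl hT''.le le_rfl
  -- `E(T″) + ν · D = E(0)`, `E(T″) ≥ 0`
  have hpos : 0 ≤ VectorCalculus.kineticEnergy (u T'') := kineticEnergy_nonneg _
  have h0 : VectorCalculus.kineticEnergy (u 0) = energy u₀ := by rw [h.initial]
  rw [h0] at hE
  set L := ∫⁻ τ in Ioo 0 T'', ∫⁻ x, ENNReal.ofReal (frobeniusNormSq (fderiv ℝ (u τ) x)) with hL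
  have hLr : L.toReal ≤ energy u₀ / ν := by
    rw [le_div_iff₀ hν]
    nlinarith
  exact (ENNReal.le_ofReal_iff_toReal_le hfin.ne (div_nonneg (kineticEnergy_nonneg _) hν.le)).2 hLr

/-- The lower-integral dissipation over the whole half-open slab `[0, T)` is bounded by `E(0)/ν`
(exhaustion of `(0, T)` by `(0, T − T/(n+2))`, monotone convergence). [cite: Tao2011, Lemma 8.1] -/
theorem lintegral_sliceD_le {ν T : ℝ} {u₀ : E3 → E3} {u : ℝ → E3 → E3} {p : ℝ → E3 → ℝ}
    (hν : 0 < ν) (h : IsSol ν T u₀ u p) (hT : 0 < T) :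
    ∫⁻ τ in Ioo 0 T, ∫⁻ x, ENNReal.ofReal (frobeniusNormSq (fderiv ℝ (u τ) x)) ≤
      ENNReal.ofReal (energy u₀ / ν) := by
  -- the exhausting sequence `Tₙ = T − T/(n+2)`
  set Ts : ℕ → ℝ := fun n => T - T / (n + 2) with hTs
  have hTs_pos : ∀ n, 0 < Ts n := fun n => by
    have hn : (2 : ℝ) ≤ n + 2 := by
      have : (0 : ℝ) ≤ n := Nat.cast_nonneg n
      linarith
    have h1 : T / (n + 2) ≤ T / 2 := div_le_div_of_nonneg_left hT.le (by norm_num) hn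
    simp only [hTs]; linarith
  have hTs_lt : ∀ n, Ts n < T := fun n => by
    have : 0 < T / (n + 2) := div_pos hT (by positivity)
    simp only [hTs]; linarith
  have hmono : Monotone fun n => Ioo (0 : ℝ) (Ts n) := by
    intro m n hmn
    refine Ioo_subset_Ioo le_rfl ?_
    simp only [hTs]
    have h2 : (0 : ℝ) < m + 2 := by positivity
    have h3 : (m : ℝ) + 2 ≤ n + 2 := by exact_mod_cast Nat.add_le_add_right hmn 2
    have := div_le_div_of_nonneg_left hT.le h2 h3
    linarith
  have hU : (⋃ n, Ioo (0 : ℝ) (Ts n)) = Ioo 0 T := by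
    ext τ
    simp only [mem_iUnion, mem_Ioo]
    constructor
    · rintro ⟨n, h0, hn⟩
      exact ⟨h0, hn.trans (hTs_lt n)⟩
    · rintro ⟨h0, hτ⟩
      obtain ⟨n, hn⟩ := exists_nat_gt (T / (T - τ))
      refine ⟨n, h0, ?_⟩
      have hTτ : 0 < T - τ := by linarith
      have hn2 : T / (T - τ) < n + 2 := by linarith
      have : T / ((n : ℝ) + 2) < T - τ := by
        rw [div_lt_iff₀ (by positivity)]
        rw [div_lt_iff₀ hTτ] at hn2
        linarith
      simp only [hTs]; linarith
  rw [← hU, setLIntegral_iUnion_of_directed _ hmono.directed_le]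
  exact iSup_le fun n => lintegral_sliceD_le_of_lt hν h (hTs_pos n) (hTs_lt n)

/-- **`Step_energyId` holds** (p.3 l.17–20 «∫₀^∞‖∇u‖²_{L²}dt = E(0)/ν < ∞», as the inequality the
sentence uses): along every solution of the typed class `IsSol`, `t ↦ ‖∇u(t)‖²_{L²}` is integrable on
`[0, T)` and `∫₀ᵀ ‖∇u‖²_{L²} ≤ E(0)/ν`.  Leray's energy law for finite-energy classical solutions
(no datum decay needed), Bochner form. [cite: Magsanop2026, §3 p.3 l.17–20] [cite: Tao2011, Lemma 8.1]
[cite: Leray1934, §17 (3.4) p. 220] -/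
theorem step_energyId_holds : Step_energyId := by
  intro ν hν u₀ _hu₀ T u p h
  have hE0 : 0 ≤ energy u₀ / ν := div_nonneg (kineticEnergy_nonneg _) hν.le
  by_cases hT : 0 < T
  swap
  · have hempty : Ico (0 : ℝ) T = ∅ := Ico_eq_empty (fun h' => hT h')
    refine ⟨?_, ?_⟩
    · rw [hempty]; exact integrableOn_empty
    · rw [hempty, Measure.restrict_empty, integral_zero_measure]; exact hE0
  -- `T > 0`
  have hDm := aemeasurable_sliceD h.classical
  have hbound := lintegral_sliceD_le hν h hT
  -- pass from `(0, T)` to `[0, T)` (a null set apart)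
  have hIco : ∫⁻ τ in Ico 0 T, ∫⁻ x, ENNReal.ofReal (frobeniusNormSq (fderiv ℝ (u τ) x)) ≤
      ENNReal.ofReal (energy u₀ / ν) := by
    rw [← setLIntegral_congr Ioo_ae_eq_Ico]; exact hbound
  have hfin : ∫⁻ τ in Ico 0 T, ∫⁻ x, ENNReal.ofReal (frobeniusNormSq (fderiv ℝ (u τ) x)) ≠ ⊤ :=
    (lt_of_le_of_lt hIco ENNReal.ofReal_lt_top).ne
  -- the printed Bochner dissipation is the `toReal` of the slice lower integral on `[0, T)`
  have hslice : ∀ᵐ τ ∂((volume : Measure ℝ).restrict (Ico 0 T)),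
      (∫⁻ x, ENNReal.ofReal (frobeniusNormSq (fderiv ℝ (u τ) x))).toReal = gradSq (u τ) := by
    filter_upwards [ae_restrict_mem measurableSet_Ico] with τ hτ
    exact (gradNormSq_eq_toReal (h.classical.contDiff_velocity hτ)).symm
  have hint : Integrable (fun τ => (∫⁻ x, ENNReal.ofReal (frobeniusNormSq (fderiv ℝ (u τ) x))).toReal)
      ((volume : Measure ℝ).restrict (Ico 0 T)) :=
    integrable_toReal_of_lintegral_ne_top hDm hfin
  refine ⟨hint.congr hslice, ?_⟩
  calc ∫ t in Ico 0 T, gradSq (u t)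
      = ∫ t in Ico 0 T, (∫⁻ x, ENNReal.ofReal (frobeniusNormSq (fderiv ℝ (u t) x))).toReal :=
        (integral_congr_ae hslice).symm
    _ = (∫⁻ t in Ico 0 T, ∫⁻ x, ENNReal.ofReal (frobeniusNormSq (fderiv ℝ (u t) x))).toReal :=
        integral_toReal hDm (ae_lt_top' hDm hfin)
    _ ≤ (ENNReal.ofReal (energy u₀ / ν)).toReal := ENNReal.toReal_mono ENNReal.ofReal_ne_top hIco
    _ = energy u₀ / ν := ENNReal.toReal_ofReal hE0

end Summit.NavierStokesRegularity.NavierStokesRegularity.Theorems.Magsanop2026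

end
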